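import Mathlib
import HarnessLib
import Summits.NavierStokesRegularity.NavierStokesRegularity.Theorems.PoloidalWindowDoorLrcModEntireTwistingTHOscSimilarityDefs

/-!
# Item `LrcModEntire` (stmt-NavierStokesRegularity-20428), skeleton twist_split v6, CLASS road to `stub_twistingTHGerm` —
# the SIMILARITY CHANGE OF VARIABLES for the plane-oscillation law (OSC): `(t,z) ↦ (τ,ξ)`, `Q = √(−t)·O`, general (non-self-similar) case

Cell ns-regularity-ideate, seat ns-k2-port-2 g3 (brick (h2-a); `--supports stmt-NavierStokesRegularity-20428 --as helper`).  The endgame of the class road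
is in the kernel in similarity variables (`…TwistingTHOscLiouville.eq_zero_of_ancient_oscSubsolution_anyK`, LEAD ns-poloidal-K2-p3 g13 ∘ port-2): a bounded
non-negative subsolution of `Q_τ + ½∂_ξ((ξ+Ŝ)Q) ≤ Q_ξξ` with `|Ŝ| ≤ A` vanishes.  The law itself is derived in the physical variables `(t,z)`, `t < 0`
(`…TwistingTHPlaneOscillationEnvelope.osc_divergence_form`: `∂ₜO + ½∂_z(S·O) − ∂_zzO ≤ 0`).  This file is the dictionary between the two, for ARBITRARY
(not self-similar) `O, S` — the generic counterpart of the LEAD's `…PlaneOscillationSimilarity.hasDerivAt_selfSimilar_time`: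
with `σ(τ) = e^{−τ/2} = √(−t)`, `t(τ) = −e^{−τ}`, `z = ξσ`,  `Q(τ,ξ) := σ·O(t,z)` (`simQ O`), `Ŝ(τ,ξ) := σ·S(t,z)` (`simQ S`) — definitions in `…TwistingTHOscSimilarityDefs`:

* `hasDerivAt_simQ_time` — `∂_τQ(τ,ξ) = σ³∂ₜO − ½σO − ½ξσ²∂_zO` (chain rule through both arguments; `O` Fréchet-differentiable at `(t,z)`);
* `deriv_simQ_xi`, `deriv_deriv_simQ_xi` — `∂_ξQ = σ²∂_zO`, `∂_ξ∂_ξQ = σ³∂_z∂_zO`;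
* `deriv_flux_sim` — `∂_ξ((ξ + Ŝ)Q) = σO + ξσ²∂_zO + σ³∂_z(S·O)`;
* `sim_operator_eq` — **the ξ-terms cancel exactly**: `∂_τQ + ½∂_ξ((ξ+Ŝ)Q) − ∂_ξξQ = σ³·(∂ₜO + ½∂_z(S·O) − ∂_zzO)` at corresponding points;
* `sim_subsolution_of_osc` — hence (OSC) in `(t,z)` for all `t < 0` ⇒ the similarity-variable subsolution inequality for all `(τ,ξ) ∈ ℝ × ℝ`
  (`σ³ > 0`), in exactly the hypothesis shape `hsub` of `eq_zero_of_ancient_oscSubsolution_anyK`; and the bound dictionary `abs_simQ_le_iff`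
  (`|Q| ≤ c ⟺ √(−t)|O| ≤ c`), `abs_simS_le_iff`.

WHAT THIS IS NOT: not a claim about Navier–Stokes regularity and not the stub — calculus (bears_on LADDER-NS N0, item 20428 / crux 19708; the regularity of the
plane envelopes that makes `O` differentiable — hypothesis (h2) — is NOT here).
-/

noncomputable section

-- the summit and its single sub-problem share the name (CONVENTIONS §1), as in every Theorems file
set_option linter.dupNamespace false

namespace Summit.NavierStokesRegularity.NavierStokesRegularity.Theorems.PoloidalWindowDoorLrcModEntireTwistingTHOscSimilarityTransform

open Set Filter Topology

open Summit.NavierStokesRegularity.NavierStokesRegularity.Theorems.PoloidalWindowDoorLrcModEntireTwistingTHOscSimilarityDefs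

/-! ### The change of variables (`sig`, `tim`, `simQ` of `…TwistingTHOscSimilarityDefs`) -/

/-- `σ > 0`. -/
theorem sig_pos (τ : ℝ) : 0 < sig τ := Real.exp_pos _

/-- `t(τ) < 0`. -/
theorem tim_neg (τ : ℝ) : tim τ < 0 := by unfold tim; exact neg_neg_of_pos (Real.exp_pos _)

/-- `σ² = −t`. -/
theorem sig_sq (τ : ℝ) : sig τ ^ 2 = -tim τ := by
  unfold sig tim; rw [neg_neg, sq, ← Real.exp_add]; ring_nf

/-- `σ′ = −σ/2`. -/
theorem hasDerivAt_sig (τ : ℝ) : HasDerivAt sig (-(sig τ / 2)) τ := by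
  have h : HasDerivAt (fun x : ℝ => Real.exp (-(x / 2))) (Real.exp (-(τ / 2)) * (-(1 / 2))) τ :=
    ((hasDerivAt_id τ).div_const 2).neg.exp
  show HasDerivAt (fun x : ℝ => Real.exp (-(x / 2))) (-(Real.exp (-(τ / 2)) / 2)) τ
  exact h.congr_deriv (by ring)

/-- `t′ = e^{−τ} = σ²`. -/
theorem hasDerivAt_tim (τ : ℝ) : HasDerivAt tim (sig τ ^ 2) τ := by
  rw [sig_sq]
  have h : HasDerivAt (fun x : ℝ => -Real.exp (-x)) (-(Real.exp (-τ) * (-1))) τ := ((hasDerivAt_id τ).neg.exp).neg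
  show HasDerivAt (fun x : ℝ => -Real.exp (-x)) (-(-Real.exp (-τ))) τ
  exact h.congr_deriv (by ring)

/-- Every `(t, z)` with `t < 0` is a similarity image: `t = tim τ`, `z = ξ·sig τ` with `τ = −log(−t)`, `ξ = z/√(−t)`. -/
theorem exists_sim_preimage {t : ℝ} (ht : t < 0) (z : ℝ) : ∃ τ ξ : ℝ, tim τ = t ∧ ξ * sig τ = z := by
  refine ⟨-Real.log (-t), z / sig (-Real.log (-t)), ?_, ?_⟩
  · unfold tim; rw [neg_neg, Real.exp_log (by linarith)]; ring
  · field_simp [(sig_pos _).ne']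

/-! ### Derivatives of `Q` -/

section Derivatives

variable {O S : ℝ → ℝ → ℝ}

/-- The space slice of a Fréchet-differentiable `uncurry O`: `deriv (O t) z = D(uncurry O)(t,z)(0,1)`. -/
theorem deriv_slice_eq {t z : ℝ} {L : ℝ × ℝ →L[ℝ] ℝ} (hO : HasFDerivAt (Function.uncurry O) L (t, z)) :
    HasDerivAt (O t) (L (0, 1)) z := by
  have h := (hO.comp z (hasFDerivAt_prodMk_right t z)).hasDerivAt
  have e : (L.comp (ContinuousLinearMap.inr ℝ ℝ ℝ)) 1 = L (0, 1) := by simp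
  rw [e] at h
  exact h

/-- **`∂_τQ`**: if `uncurry O` is Fréchet-differentiable at `(t(τ), ξσ(τ))` with derivative `L`, then
`τ' ↦ Q(τ',ξ)` has derivative `σ³·L(1,0) − ½σ·O − ½ξσ²·L(0,1)` at `τ` (`L(1,0) = ∂ₜO`, `L(0,1) = ∂_zO` at the point). -/
theorem hasDerivAt_simQ_time {τ ξ : ℝ} {L : ℝ × ℝ →L[ℝ] ℝ}
    (hO : HasFDerivAt (Function.uncurry O) L (tim τ, ξ * sig τ)) :
    HasDerivAt (fun τ' => simQ O τ' ξ)
      (sig τ ^ 3 * L (1, 0) - (1 / 2 : ℝ) * sig τ * O (tim τ) (ξ * sig τ) - (1 / 2 : ℝ) * ξ * sig τ ^ 2 * L (0, 1)) τ := by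
  -- the curve `τ' ↦ (t(τ'), ξσ(τ'))`
  have hγ : HasDerivAt (fun τ' => (tim τ', ξ * sig τ')) (sig τ ^ 2, ξ * (-(sig τ / 2))) τ :=
    (hasDerivAt_tim τ).prodMk ((hasDerivAt_sig τ).const_mul ξ)
  have hcomp : HasDerivAt (fun τ' => O (tim τ') (ξ * sig τ')) (L (sig τ ^ 2, ξ * (-(sig τ / 2)))) τ := by
    have h := hO.comp_hasDerivAt τ hγ
    exact h
  have hprod := (hasDerivAt_sig τ).mul hcomp
  have hpair : L (sig τ ^ 2, ξ * (-(sig τ / 2))) = sig τ ^ 2 * L (1, 0) + ξ * (-(sig τ / 2)) * L (0, 1) := by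
    have e : ((sig τ ^ 2, ξ * (-(sig τ / 2))) : ℝ × ℝ) = (sig τ ^ 2) • ((1 : ℝ), (0 : ℝ)) + (ξ * (-(sig τ / 2))) • ((0 : ℝ), (1 : ℝ)) := by
      ext <;> simp
    rw [e, map_add, map_smul, map_smul, smul_eq_mul, smul_eq_mul]
  unfold simQ
  refine hprod.congr_deriv ?_
  rw [hpair]
  ring

/-- **`∂_ξQ = σ²·∂_zO`** (at the corresponding point). -/
theorem hasDerivAt_simQ_xi {τ ξ : ℝ} (hO : DifferentiableAt ℝ (O (tim τ)) (ξ * sig τ)) :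
    HasDerivAt (simQ O τ) (sig τ ^ 2 * deriv (O (tim τ)) (ξ * sig τ)) ξ := by
  have hlin : HasDerivAt (fun ξ' : ℝ => ξ' * sig τ) (sig τ) ξ := by
    simpa using (hasDerivAt_id ξ).mul_const (sig τ)
  have h := (hO.hasDerivAt.comp ξ hlin).const_mul (sig τ)
  unfold simQ
  refine h.congr_deriv ?_
  ring

/-- `∂_ξQ` as a function. -/
theorem deriv_simQ_xi {τ : ℝ} (hO : Differentiable ℝ (O (tim τ))) :
    deriv (simQ O τ) = fun ξ => sig τ ^ 2 * deriv (O (tim τ)) (ξ * sig τ) :=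
  funext fun _ => (hasDerivAt_simQ_xi (hO _)).deriv

/-- **`∂_ξ∂_ξQ = σ³·∂_z∂_zO`.** -/
theorem deriv_deriv_simQ_xi {τ : ℝ} (hO : Differentiable ℝ (O (tim τ))) (hO2 : Differentiable ℝ (deriv (O (tim τ)))) (ξ : ℝ) :
    deriv (deriv (simQ O τ)) ξ = sig τ ^ 3 * deriv (deriv (O (tim τ))) (ξ * sig τ) := by
  rw [deriv_simQ_xi hO]
  have hlin : HasDerivAt (fun ξ' : ℝ => ξ' * sig τ) (sig τ) ξ := by
    simpa using (hasDerivAt_id ξ).mul_const (sig τ)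
  have h : HasDerivAt (fun ξ' => sig τ ^ 2 * deriv (O (tim τ)) (ξ' * sig τ))
      (sig τ ^ 2 * (deriv (deriv (O (tim τ))) (ξ * sig τ) * sig τ)) ξ :=
    ((hO2 _).hasDerivAt.comp ξ hlin).const_mul (sig τ ^ 2)
  rw [h.deriv]; ring

/-- **The flux derivative**: `∂_ξ((ξ + Ŝ)Q) = σO + ξσ²∂_zO + σ³∂_z(S·O)` with `Ŝ = σ·S(t, ξσ)`. -/
theorem hasDerivAt_flux_sim {τ ξ : ℝ} (hO : DifferentiableAt ℝ (O (tim τ)) (ξ * sig τ))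
    (hS : DifferentiableAt ℝ (S (tim τ)) (ξ * sig τ)) :
    HasDerivAt (fun ξ' => (ξ' + simQ S τ ξ') * simQ O τ ξ')
      (sig τ * O (tim τ) (ξ * sig τ) + ξ * sig τ ^ 2 * deriv (O (tim τ)) (ξ * sig τ)
        + sig τ ^ 3 * deriv (fun z => S (tim τ) z * O (tim τ) z) (ξ * sig τ)) ξ := by
  have hQ := hasDerivAt_simQ_xi (O := O) hO
  have hSQ := hasDerivAt_simQ_xi (O := S) hS
  have h := ((hasDerivAt_id ξ).add hSQ).mul hQ
  refine h.congr_deriv ?_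
  rw [deriv_fun_mul hS hO]
  simp only [simQ, Pi.add_apply, id_eq]
  ring

/-- **THE ξ-TERMS CANCEL**: with `Qt` the `τ`-derivative value of `hasDerivAt_simQ_time`,
`Qt + ½∂_ξ((ξ+Ŝ)Q) − ∂_ξ∂_ξQ = σ³·(∂ₜO + ½∂_z(S·O) − ∂_z∂_zO)` at corresponding points. -/
theorem sim_operator_eq {τ ξ : ℝ} {L : ℝ × ℝ →L[ℝ] ℝ}
    (hOF : HasFDerivAt (Function.uncurry O) L (tim τ, ξ * sig τ))
    (hO : Differentiable ℝ (O (tim τ))) (hO2 : Differentiable ℝ (deriv (O (tim τ))))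
    (hS : DifferentiableAt ℝ (S (tim τ)) (ξ * sig τ)) :
    (sig τ ^ 3 * L (1, 0) - (1 / 2 : ℝ) * sig τ * O (tim τ) (ξ * sig τ) - (1 / 2 : ℝ) * ξ * sig τ ^ 2 * L (0, 1))
        + (1 / 2 : ℝ) * deriv (fun ξ' => (ξ' + simQ S τ ξ') * simQ O τ ξ') ξ - deriv (deriv (simQ O τ)) ξ =
      sig τ ^ 3 * (L (1, 0) + (1 / 2 : ℝ) * deriv (fun z => S (tim τ) z * O (tim τ) z) (ξ * sig τ)
        - deriv (deriv (O (tim τ))) (ξ * sig τ)) := by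
  rw [(hasDerivAt_flux_sim (hO _) hS).deriv, deriv_deriv_simQ_xi hO hO2]
  have hz : L (0, 1) = deriv (O (tim τ)) (ξ * sig τ) := ((deriv_slice_eq hOF).deriv).symm
  rw [hz]
  ring

end Derivatives

/-! ### Transfer of (OSC) and of the bounds -/

section Transfer

variable {O S : ℝ → ℝ → ℝ} {Od : ℝ → ℝ → (ℝ × ℝ →L[ℝ] ℝ)}

/-- **(OSC) in `(t,z)` ⇒ the similarity-variable subsolution inequality**, in the hypothesis shape of
`…TwistingTHOscLiouville.eq_zero_of_ancient_oscSubsolution_anyK` (`Qt τ ξ :=` the derivative value of `hasDerivAt_simQ_time`). -/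
theorem sim_subsolution_of_osc
    (hOF : ∀ t < 0, ∀ z, HasFDerivAt (Function.uncurry O) (Od t z) (t, z))
    (hO2 : ∀ t < 0, Differentiable ℝ (deriv (O t))) (hS : ∀ t < 0, Differentiable ℝ (S t))
    (hosc : ∀ t < 0, ∀ z, Od t z (1, 0) + (1 / 2 : ℝ) * deriv (fun z => S t z * O t z) z - deriv (deriv (O t)) z ≤ 0) (τ ξ : ℝ) :
    (sig τ ^ 3 * Od (tim τ) (ξ * sig τ) (1, 0) - (1 / 2 : ℝ) * sig τ * O (tim τ) (ξ * sig τ)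
        - (1 / 2 : ℝ) * ξ * sig τ ^ 2 * Od (tim τ) (ξ * sig τ) (0, 1))
      + (1 / 2 : ℝ) * deriv (fun ξ' => (ξ' + simQ S τ ξ') * simQ O τ ξ') ξ ≤ deriv (deriv (simQ O τ)) ξ := by
  have ht := tim_neg τ
  have hO : Differentiable ℝ (O (tim τ)) := fun z => (deriv_slice_eq (hOF _ ht z)).differentiableAt
  have h := sim_operator_eq (S := S) (ξ := ξ) (hOF _ ht (ξ * sig τ)) hO (hO2 _ ht) (hS _ ht (ξ * sig τ))
  have hs3 : 0 < sig τ ^ 3 := pow_pos (sig_pos τ) 3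
  have hle := mul_nonpos_of_nonneg_of_nonpos hs3.le (hosc _ ht (ξ * sig τ))
  linarith

/-- Time-differentiability of `Q` in the shape `hQt` of the Liouville lemma. -/
theorem hasDerivAt_simQ_of_fderiv (hOF : ∀ t < 0, ∀ z, HasFDerivAt (Function.uncurry O) (Od t z) (t, z)) (τ ξ : ℝ) :
    HasDerivAt (fun τ' => simQ O τ' ξ)
      (sig τ ^ 3 * Od (tim τ) (ξ * sig τ) (1, 0) - (1 / 2 : ℝ) * sig τ * O (tim τ) (ξ * sig τ)
        - (1 / 2 : ℝ) * ξ * sig τ ^ 2 * Od (tim τ) (ξ * sig τ) (0, 1)) τ :=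
  hasDerivAt_simQ_time (hOF _ (tim_neg τ) _)

/-- **Bound dictionary, value**: `|Q(τ,ξ)| ≤ c` for all `(τ,ξ)` iff `√(−t)·|O(t,z)| ≤ c` for all `t < 0`, `z`. -/
theorem abs_simQ_le_iff {c : ℝ} :
    (∀ τ ξ, |simQ O τ ξ| ≤ c) ↔ ∀ t < 0, ∀ z, Real.sqrt (-t) * |O t z| ≤ c := by
  constructor
  · intro h t ht z
    obtain ⟨τ, ξ, hτ, hξ⟩ := exists_sim_preimage ht z
    have h1 := h τ ξ
    unfold simQ at h1
    rw [hτ, hξ, abs_mul, abs_of_pos (sig_pos τ)] at h1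
    have e : Real.sqrt (-t) = sig τ := by
      rw [← hτ, ← sig_sq, Real.sqrt_sq (sig_pos τ).le]
    rwa [e]
  · intro h τ ξ
    have h1 := h (tim τ) (tim_neg τ) (ξ * sig τ)
    unfold simQ
    rw [abs_mul, abs_of_pos (sig_pos τ)]
    have e : Real.sqrt (-tim τ) = sig τ := by rw [← sig_sq, Real.sqrt_sq (sig_pos τ).le]
    rwa [e] at h1

/-- **Bound dictionary, non-negativity**. -/
theorem simQ_nonneg_iff : (∀ τ ξ, 0 ≤ simQ O τ ξ) ↔ ∀ t < 0, ∀ z, 0 ≤ O t z := by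
  constructor
  · intro h t ht z
    obtain ⟨τ, ξ, hτ, hξ⟩ := exists_sim_preimage ht z
    have h1 := h τ ξ
    unfold simQ at h1; rw [hτ, hξ] at h1
    exact (mul_nonneg_iff_of_pos_left (sig_pos τ)).1 h1
  · intro h τ ξ
    exact mul_nonneg (sig_pos τ).le (h _ (tim_neg τ) _)

end Transfer

end Summit.NavierStokesRegularity.NavierStokesRegularity.Theorems.PoloidalWindowDoorLrcModEntireTwistingTHOscSimilarityTransform
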